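import Literature.Computability.AlgebraicComplexity.BI17TensorStabilizerCharts
import Mathlib.Data.Fintype.Pigeonhole
import HarnessLib

/-!
# Almost all `w ∈ ⊗³ℂ^m`, `m > 3`, have a trivial stabilizer (A. M. Popov 1987; BI 2017 Thm. 4.2) — proofs

Bürgisser–Ikenmeyer 2017, proof of Thm. 4.2 (arXiv:1511.02927, TeX L1616–1618): "if `m > 3`, then
almost all `w ∈ ⊗³ℂ^m` have a trivial stabilizer group [A. M. Popov 1987, Thm. 2], hence
`a(m) = 1`" — the tree's fact `BI2017_popov_trivialStabilizer` (`BI17FundamentalInvariantTensors`),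
DISCHARGED here: `BI2017_popov_trivialStabilizer_holds`; with the tree's edge
`BI2017_thm_4_2_of_popov` this also discharges `BI2017_thm_4_2` (`BI2017_thm_4_2_holds`).

## Proof (ours; elementary — the tensor twin of `GenericTrivialStabilizerProofs`)

Route ≠ Popov's (classification of irreducible semisimple linear groups with finite generic
stabilizer). For `w ∈ ⊗³ℂ^m`, `m ≥ 4`, and `g = (g₁,g₂,g₃) ∈ GL_m³` with `g·w = w`:
1. (`finite_mixedStab_of_hasTrivialMixedLieStabilizer`, the Lie-algebra criterion of
   `BI17TensorFiniteStabilizerLocusProofs` for the group `GL_m × SL_m × SL_m`) if the only triple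
   `(X,Y,Z)` with `tr Y = tr Z = 0` and `(X ⊗ 1 ⊗ 1 + 1 ⊗ Y ⊗ 1 + 1 ⊗ 1 ⊗ Z)·w = 0` is `0`, then the
   MIXED stabilizer `{g ∈ GL × GL × GL : g·w = w, det g₂ = det g₃ = 1}` is finite; this Lie
   condition is Zariski-generic (semicontinuity from the witness `bandWitness` of
   `BI17TensorGenericFiniteStabilizer`, whose full infinitesimal stabilizer is the torus algebra,
   `hasTrivialMixedLieStabilizer_bandWitness`);
2. rescaling `g` by scalars `(t₁,t₂,t₃)`, `t₁t₂t₃ = 1`, `t₂^m = det g₂⁻¹`, `t₃^m = det g₃⁻¹`, puts it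
   in the mixed stabilizer, so it has finite order there; hence each `gₛ` is diagonalisable
   (`exists_mul_eq_mul_diagonal_of_pow_eq_one`), `gₛ Pₛ = Pₛ diag(aₛ)`;
3. (`BI17TensorStabilizerCharts`) either all three eigenvalue tuples are constant — then
   `g = (ζ₁ I, ζ₂ I, ζ₃ I)` with `ζ₁ζ₂ζ₃ = 1` as `w ≠ 0` — or `w` lies in the image of the triple
   pivot chart of the eigenvalue blocks applied to tensors supported on
   `S = {(i,j,k) : a_i b_j c_k = 1}`, a polynomial family with fewer than `m³` parameters
   (`card_nePairs_add_card_fixSupport_lt`, this is where `m ≥ 4` enters), which almost all `w`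
   avoid (`isZariskiGenericTensor_not_mem_tensorChartImage`); there are finitely many charts.

Honest framing: a classical theorem (A. M. Popov 1987, as quoted by BI) re-proved by counting;
typed ≠ endorsed; nothing here bears on VP versus VNP.
[cite: BurgisserIkenmeyer2017, Thm. 4.2 (proof, "if m > 3, then almost all w have a trivial stabilizer")]

## References

* P. Bürgisser, C. Ikenmeyer, *Fundamental invariants of orbit closures*, J. Algebra 477 (2017),
  §4.1 and Thm. 4.2, TeX L1574–1618. [BurgisserIkenmeyer2017]
* A. M. Popov, *Irreducible semisimple linear Lie groups with finite stationary subgroups of general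
  position*, Trudy Moskov. Mat. Obshch. 50 (1987) 209–248, Thm. 2 (as quoted by BI). [Popov1987]
* T. A. Springer, *Linear Algebraic Groups*, 2nd ed. (1998), Thm. 4.3.3 (iii). [SpringerLAG1998]

## Tree

`HasTrivialSL3LieStabilizer`, `sl3LieMatrix` (+ `_map`, `_mulVec_inl`, `_mulVec_inr`)
(`BI17TensorFiniteStabilizerLocusProofs`); `bandWitness`, `lieAction_bandWitness_apply`
(`BI17TensorGenericFiniteStabilizer`); `tensorChartImage`,
`isZariskiGenericTensor_not_mem_tensorChartImage`, `exists_tensorEigenChart`, `tripleChartMatrix`,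
`fixSupport`, `card_tripleChartVars`, `card_nePairs_add_card_fixSupport_lt`,
`IsZariskiGenericTensor.forall_fintype`, `isZariskiGenericTensor_ne_zero`
(`BI17TensorStabilizerCharts`); `exists_mem_minimalPrimes_inter_infinite`,
`height_le_finrank_tangentSpaceAt`, `dualNumberPoint`, `linearFormOfVector`
(`Literature.RingTheory.KrullDimension`); `exists_mul_eq_mul_diagonal_of_pow_eq_one`
(`ClassicalInvariants.LinearSubstitution`); `BI2017_thm_4_2_of_popov` (`BI17GenericPeriodThreeProofs`).
-/

set_option Elab.async false

noncomputable section

namespace Literature.Computability.AlgebraicComplexity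

open MvPolynomial Literature.RingTheory.KrullDimension

/-- The three elements of `Fin 3`. [folklore] -/
private theorem fin3_cases (s : Fin 3) : s = 0 ∨ s = 1 ∨ s = 2 := by
  revert s; decide

/-! ### The mixed infinitesimal stabilizer and its matrix -/

section MixedLie

variable {ι K : Type*} [Fintype ι] [DecidableEq ι] [CommRing K]

/-- **The mixed infinitesimal stabilizer of `w ∈ ⊗³K^ι` is zero**: for `X ∈ 𝔤𝔩`, `Y, Z ∈ 𝔰𝔩`
(trace zero), `(X ⊗ 1 ⊗ 1 + 1 ⊗ Y ⊗ 1 + 1 ⊗ 1 ⊗ Z)·w = 0` only for `X = Y = Z = 0` — the Lie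
algebra of the stabilizer of `w` in `GL × SL × SL` (BI 2017 §4.1 eq. (4.1)) computed at the
identity is trivial. [cite: BurgisserIkenmeyer2017, §4.1 eq. (4.1) and Thm. 4.2 (proof)] -/
def HasTrivialMixedLieStabilizer (w : ι → ι → ι → K) : Prop :=
  ∀ X Y Z : Matrix ι ι K, Y.trace = 0 → Z.trace = 0 →
    actTensor X (1 : Matrix ι ι K) (1 : Matrix ι ι K) w +
        actTensor (1 : Matrix ι ι K) Y (1 : Matrix ι ι K) w +
        actTensor (1 : Matrix ι ι K) (1 : Matrix ι ι K) Z w = 0 →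
      X = 0 ∧ Y = 0 ∧ Z = 0

/-- The mixed condition implies the traceless one (`HasTrivialSL3LieStabilizer`).
[cite: BurgisserIkenmeyer2017, §4.1 eq. (4.1)] -/
theorem HasTrivialMixedLieStabilizer.hasTrivialSL3LieStabilizer {w : ι → ι → ι → K}
    (h : HasTrivialMixedLieStabilizer w) : HasTrivialSL3LieStabilizer w :=
  fun X Y Z _ hY hZ hL => h X Y Z hY hZ hL

omit [Fintype ι] in
/-- **The matrix of the mixed infinitesimal action** `(X₀,X₁,X₂) ↦ ((X₀ ⊗ 1 ⊗ 1 + 1 ⊗ X₁ ⊗ 1 +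
1 ⊗ 1 ⊗ X₂)·w, tr X₁, tr X₂)`: the rows of `sl3LieMatrix w` except the trace row of `X₀`.
[cite: BurgisserIkenmeyer2017, §4.1 (stabilizer) and Thm. 4.2 (proof)] -/
def mixedLieMatrix (w : ι → ι → ι → K) : Matrix ((ι × ι × ι) ⊕ Fin 2) (Fin 3 × ι × ι) K :=
  (sl3LieMatrix w).submatrix (Sum.map id Fin.succ) id

omit [Fintype ι] in
/-- `mixedLieMatrix` commutes with ring homomorphisms. [cite: BurgisserIkenmeyer2017, §4.1] -/
theorem mixedLieMatrix_map {L : Type*} [CommRing L] {F : Type*} [FunLike F K L] [RingHomClass F K L]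
    (f : F) (w : ι → ι → ι → K) :
    (mixedLieMatrix w).map f = mixedLieMatrix fun a b c => f (w a b c) := by
  rw [mixedLieMatrix, mixedLieMatrix, ← Matrix.submatrix_map, sl3LieMatrix_map]

/-- The tensor rows of `mixedLieMatrix w · vec(X₀,X₁,X₂)`. [cite: BurgisserIkenmeyer2017, §4.1] -/
theorem mixedLieMatrix_mulVec_inl (w : ι → ι → ι → K) (v : Fin 3 × ι × ι → K) (a b c : ι) :
    ((mixedLieMatrix w).mulVec v) (Sum.inl (a, b, c)) =
      (actTensor (Matrix.of fun i j => v (0, i, j)) (1 : Matrix ι ι K) (1 : Matrix ι ι K) w +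
        actTensor (1 : Matrix ι ι K) (Matrix.of fun i j => v (1, i, j)) (1 : Matrix ι ι K) w +
        actTensor (1 : Matrix ι ι K) (1 : Matrix ι ι K) (Matrix.of fun i j => v (2, i, j)) w)
        a b c := by
  rw [← sl3LieMatrix_mulVec_inl]
  rfl

/-- The first trace row of `mixedLieMatrix w · vec(X₀,X₁,X₂)` is `tr X₁`.
[cite: BurgisserIkenmeyer2017, §4.1] -/
theorem mixedLieMatrix_mulVec_inr_zero (w : ι → ι → ι → K) (v : Fin 3 × ι × ι → K) :
    ((mixedLieMatrix w).mulVec v) (Sum.inr 0) = (Matrix.of fun i j => v (1, i, j)).trace := by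
  rw [← sl3LieMatrix_mulVec_inr w v 1]
  rfl

/-- The second trace row of `mixedLieMatrix w · vec(X₀,X₁,X₂)` is `tr X₂`.
[cite: BurgisserIkenmeyer2017, §4.1] -/
theorem mixedLieMatrix_mulVec_inr_one (w : ι → ι → ι → K) (v : Fin 3 × ι × ι → K) :
    ((mixedLieMatrix w).mulVec v) (Sum.inr 1) = (Matrix.of fun i j => v (2, i, j)).trace := by
  rw [← sl3LieMatrix_mulVec_inr w v 2]
  rfl

/-- **Injectivity of `mixedLieMatrix w` gives a zero mixed infinitesimal stabilizer.**
[cite: BurgisserIkenmeyer2017, §4.1 and Thm. 4.2 (proof)] -/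
theorem hasTrivialMixedLieStabilizer_of_mulVec_injective (w : ι → ι → ι → K)
    (hinj : Function.Injective (mixedLieMatrix w).mulVec) : HasTrivialMixedLieStabilizer w := by
  intro X Y Z hY hZ hsum
  let v : Fin 3 × ι × ι → K := fun p => ![X, Y, Z] p.1 p.2.1 p.2.2
  have e0 : (Matrix.of fun i j => v (0, i, j)) = X := Matrix.ext fun _ _ => rfl
  have e1 : (Matrix.of fun i j => v (1, i, j)) = Y := Matrix.ext fun _ _ => rfl
  have e2 : (Matrix.of fun i j => v (2, i, j)) = Z := Matrix.ext fun _ _ => rfl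
  have hv : (mixedLieMatrix w).mulVec v = 0 := by
    funext r
    rcases r with ⟨a, b, c⟩ | s
    · rw [mixedLieMatrix_mulVec_inl, e0, e1, e2, hsum]
      rfl
    · rw [Pi.zero_apply]
      rcases Fin.exists_fin_two.mp ⟨s, rfl⟩ with rfl | rfl
      · rw [mixedLieMatrix_mulVec_inr_zero]; exact (congrArg Matrix.trace e1).trans hY
      · rw [mixedLieMatrix_mulVec_inr_one]; exact (congrArg Matrix.trace e2).trans hZ
  have hv0 : v = 0 := hinj (by rw [hv, Matrix.mulVec_zero])
  refine ⟨?_, ?_, ?_⟩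
  · rw [← e0, hv0]; rfl
  · rw [← e1, hv0]; rfl
  · rw [← e2, hv0]; rfl

/-- Conversely a zero mixed infinitesimal stabilizer is injectivity of `mixedLieMatrix w`.
[cite: BurgisserIkenmeyer2017, §4.1 and Thm. 4.2 (proof)] -/
theorem mulVec_injective_of_hasTrivialMixedLieStabilizer (w : ι → ι → ι → K)
    (h : HasTrivialMixedLieStabilizer w) : Function.Injective (mixedLieMatrix w).mulVec := by
  intro v v' hvv'
  rw [← sub_eq_zero]
  set d : Fin 3 × ι × ι → K := v - v' with hd
  have hMd : (mixedLieMatrix w).mulVec d = 0 := by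
    rw [hd, Matrix.mulVec_sub, hvv', sub_self]
  obtain ⟨h0, h1, h2⟩ := h (Matrix.of fun i j => d (0, i, j)) (Matrix.of fun i j => d (1, i, j))
    (Matrix.of fun i j => d (2, i, j))
    (by rw [← mixedLieMatrix_mulVec_inr_zero w d, hMd, Pi.zero_apply])
    (by rw [← mixedLieMatrix_mulVec_inr_one w d, hMd, Pi.zero_apply])
    (by
      funext a b c
      rw [← mixedLieMatrix_mulVec_inl w d a b c, hMd]
      rfl)
  funext p
  obtain ⟨s, i, j⟩ := p
  rcases fin3_cases s with rfl | rfl | rfl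
  · exact congr_fun (congr_fun h0 i) j
  · exact congr_fun (congr_fun h1 i) j
  · exact congr_fun (congr_fun h2 i) j

end MixedLie

/-! ### Semicontinuity: one tensor with zero mixed infinitesimal stabilizer makes it generic -/

section Semicontinuity

variable {ι : Type*} [Fintype ι] [DecidableEq ι]

/-- A matrix over `ℂ` with injective `mulVec` has a non-singular square submatrix on some rows.
[folklore] -/
private theorem exists_submatrix_det_ne_zero {ρ κ : Type*} [Fintype ρ] [Fintype κ] [DecidableEq κ]
    (A : Matrix ρ κ ℂ) (hA : Function.Injective A.mulVec) :
    ∃ e : κ → ρ, (A.submatrix e id).det ≠ 0 := by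
  classical
  have hrank : A.rank = Fintype.card κ := by
    have hinj : Function.Injective A.mulVecLin := fun x y hxy => hA hxy
    rw [Matrix.rank, LinearMap.finrank_range_of_inj hinj, Module.finrank_fintype_fun_eq_card]
  obtain ⟨κ', a, ha, hspan, hli⟩ := exists_linearIndependent' (K := ℂ) A.row
  haveI : Finite κ' := hli.finite
  letI : Fintype κ' := Fintype.ofFinite κ'
  have hcard : Fintype.card κ' = Fintype.card κ := by
    rw [linearIndependent_iff_card_eq_finrank_span.mp hli, Set.finrank, hspan,
      ← Matrix.rank_eq_finrank_span_row, hrank]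
  obtain ⟨e⟩ : Nonempty (κ ≃ κ') := Fintype.card_eq.mp hcard.symm
  refine ⟨a ∘ e, ?_⟩
  have hli' : LinearIndependent ℂ (A.submatrix (a ∘ e) id).row := by
    have : (A.submatrix (a ∘ e) id).row = (A.row ∘ a) ∘ e := by
      funext i; rfl
    rw [this]
    exact hli.comp e e.injective
  have hU := Matrix.linearIndependent_rows_iff_isUnit.mp hli'
  rw [Matrix.isUnit_iff_isUnit_det] at hU
  exact hU.ne_zero

/-- **Upper semicontinuity for the mixed condition**: ONE tensor `w₀` with zero mixed
infinitesimal stabilizer makes `HasTrivialMixedLieStabilizer` Zariski-generic (test polynomial: a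
maximal minor of the generic `mixedLieMatrix`, non-singular at `w₀`).
[cite: BurgisserIkenmeyer2017, §4.1 ("almost all") and Thm. 4.2 (proof)] -/
theorem isZariskiGenericTensor_hasTrivialMixedLieStabilizer_of_exists (w₀ : ι → ι → ι → ℂ)
    (h₀ : HasTrivialMixedLieStabilizer w₀) :
    IsZariskiGenericTensor (fun w : ι → ι → ι → ℂ => HasTrivialMixedLieStabilizer w) := by
  classical
  obtain ⟨e, he⟩ := exists_submatrix_det_ne_zero _
    (mulVec_injective_of_hasTrivialMixedLieStabilizer w₀ h₀)
  let Mgen : Matrix ((ι × ι × ι) ⊕ Fin 2) (Fin 3 × ι × ι) (MvPolynomial (ι × ι × ι) ℂ) :=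
    mixedLieMatrix fun a b c => X (a, b, c)
  let F : MvPolynomial (ι × ι × ι) ℂ := (Mgen.submatrix e id).det
  have hevalM : ∀ w : ι → ι → ι → ℂ, Mgen.map (aeval (tensorPt w)) = mixedLieMatrix w := by
    intro w
    show (mixedLieMatrix fun a b c => (X (a, b, c) : MvPolynomial (ι × ι × ι) ℂ)).map
      (aeval (tensorPt w)) = mixedLieMatrix w
    rw [mixedLieMatrix_map]
    congr 1
    funext a b c
    rw [aeval_X]
    rfl
  have hevalF : ∀ w : ι → ι → ι → ℂ,
      aeval (tensorPt w) F = ((mixedLieMatrix w).submatrix e id).det := by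
    intro w
    show aeval (tensorPt w) (Mgen.submatrix e id).det = _
    rw [AlgHom.map_det, AlgHom.mapMatrix_apply, ← Matrix.submatrix_map, hevalM]
  refine ⟨F, ?_, fun w hw => ?_⟩
  · intro hF0
    have h1 := hevalF w₀
    rw [hF0, map_zero] at h1
    exact he h1.symm
  · rw [hevalF] at hw
    apply hasTrivialMixedLieStabilizer_of_mulVec_injective
    intro v v' hvv'
    rw [← sub_eq_zero]
    apply Matrix.eq_zero_of_mulVec_eq_zero hw
    rw [Matrix.mulVec_sub]
    have h1 : ((mixedLieMatrix w).submatrix e id).mulVec v =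
        ((mixedLieMatrix w).submatrix e id).mulVec v' := by
      funext i
      have := congr_fun hvv' (e i)
      simpa [Matrix.mulVec, dotProduct, Matrix.submatrix_apply] using this
    rw [h1, sub_self]

end Semicontinuity

/-! ### The mixed stabilizer and the Lie-algebra criterion -/

section MixedStab

variable {ι k : Type*} [Fintype ι] [DecidableEq ι] [Field k]

/-- The **mixed stabilizer** of `w ∈ ⊗³k^ι`: the triples `(g₁,g₂,g₃) ∈ GL³` with `g·w = w` and
`det g₂ = det g₃ = 1` — the stabilizer of `w` in `GL × SL × SL`, as a subset of `GL³` (every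
element of `stab(w)` rescales into it by `(t₁,t₂,t₃)` with `t₁t₂t₃ = 1`).
[cite: BurgisserIkenmeyer2017, §4.1 eq. (4.1) and Thm. 4.2 (proof)] -/
def mixedStab (w : ι → ι → ι → k) : Set (GL ι k × GL ι k × GL ι k) :=
  {g | actTensor (g.1 : Matrix ι ι k) (g.2.1 : Matrix ι ι k) (g.2.2 : Matrix ι ι k) w = w ∧
    (g.2.1 : Matrix ι ι k).det = 1 ∧ (g.2.2 : Matrix ι ι k).det = 1}

/-- Membership in `mixedStab`, unfolded. [cite: BurgisserIkenmeyer2017, §4.1 eq. (4.1)] -/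
theorem mem_mixedStab_iff (w : ι → ι → ι → k) (g : GL ι k × GL ι k × GL ι k) :
    g ∈ mixedStab w ↔
      actTensor (g.1 : Matrix ι ι k) (g.2.1 : Matrix ι ι k) (g.2.2 : Matrix ι ι k) w = w ∧
        (g.2.1 : Matrix ι ι k).det = 1 ∧ (g.2.2 : Matrix ι ι k).det = 1 :=
  Iff.rfl

/-- `mixedStab w` contains `1`. [cite: BurgisserIkenmeyer2017, §4.1 eq. (4.1)] -/
theorem one_mem_mixedStab (w : ι → ι → ι → k) : (1 : GL ι k × GL ι k × GL ι k) ∈ mixedStab w := by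
  refine ⟨?_, ?_, ?_⟩
  · simp only [Prod.fst_one, Prod.snd_one, Units.val_one, actTensor_one]
  · simp only [Prod.snd_one, Prod.fst_one, Units.val_one, Matrix.det_one]
  · simp only [Prod.snd_one, Units.val_one, Matrix.det_one]

/-- `mixedStab w` is closed under products. [cite: BurgisserIkenmeyer2017, §4.1 eq. (4.1)] -/
theorem mul_mem_mixedStab {w : ι → ι → ι → k} {g h : GL ι k × GL ι k × GL ι k}
    (hg : g ∈ mixedStab w) (hh : h ∈ mixedStab w) : g * h ∈ mixedStab w := by
  obtain ⟨hg1, hg2, hg3⟩ := hg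
  obtain ⟨hh1, hh2, hh3⟩ := hh
  refine ⟨?_, ?_, ?_⟩
  · simp only [Prod.fst_mul, Prod.snd_mul, Units.val_mul]
    rw [← actTensor_actTensor, hh1, hg1]
  · simp only [Prod.snd_mul, Prod.fst_mul, Units.val_mul, Matrix.det_mul, hg2, hh2, mul_one]
  · simp only [Prod.snd_mul, Units.val_mul, Matrix.det_mul, hg3, hh3, mul_one]

/-- `mixedStab w` is closed under powers. [cite: BurgisserIkenmeyer2017, §4.1 eq. (4.1)] -/
theorem pow_mem_mixedStab {w : ι → ι → ι → k} {g : GL ι k × GL ι k × GL ι k}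
    (hg : g ∈ mixedStab w) (n : ℕ) : g ^ n ∈ mixedStab w := by
  induction n with
  | zero => rw [pow_zero]; exact one_mem_mixedStab w
  | succ n ih => rw [pow_succ]; exact mul_mem_mixedStab ih hg

end MixedStab

section Finite

open TrivSqZeroExt DualNumber

variable {ι : Type*} [Fintype ι] [DecidableEq ι]

omit [DecidableEq ι] in
/-- Evaluating the generic action polynomial `((Y₀ ⊗ Y₁ ⊗ Y₂)·w)_{abc}` at a point of `(Mat)³`
with values in a `ℂ`-algebra. [folklore] -/
private theorem aeval_actTensor_X {R : Type*} [CommRing R] [Algebra ℂ R] (w : ι → ι → ι → ℂ)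
    (y : Fin 3 × ι × ι → R) (a b c : ι) :
    aeval y ((actTensor (Matrix.of fun i j => (X (0, i, j) : MvPolynomial (Fin 3 × ι × ι) ℂ))
        (Matrix.of fun i j => (X (1, i, j) : MvPolynomial (Fin 3 × ι × ι) ℂ))
        (Matrix.of fun i j => (X (2, i, j) : MvPolynomial (Fin 3 × ι × ι) ℂ))
        fun a b c => C (w a b c)) a b c) =
      actTensor (Matrix.of fun i j => y (0, i, j)) (Matrix.of fun i j => y (1, i, j))
        (Matrix.of fun i j => y (2, i, j)) (fun a b c => algebraMap ℂ R (w a b c)) a b c := by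
  simp only [actTensor_apply, map_sum, map_mul, aeval_X, aeval_C, Matrix.of_apply]

omit [DecidableEq ι] in
/-- The `ε`-part of `((A ⊗ B ⊗ C)·w)_{abc}` over `ℂ[ε]`. [folklore] -/
private theorem snd_actTensor_inl (A B C : Matrix ι ι ℂ[ε]) (w : ι → ι → ι → ℂ) (a b c : ι) :
    TrivSqZeroExt.snd (actTensor A B C (fun a b c => (inl (w a b c) : ℂ[ε])) a b c) =
      (actTensor (A.map TrivSqZeroExt.snd) (B.map TrivSqZeroExt.fst) (C.map TrivSqZeroExt.fst) w +
        actTensor (A.map TrivSqZeroExt.fst) (B.map TrivSqZeroExt.snd) (C.map TrivSqZeroExt.fst) w +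
        actTensor (A.map TrivSqZeroExt.fst) (B.map TrivSqZeroExt.fst) (C.map TrivSqZeroExt.snd) w)
        a b c := by
  simp only [actTensor_apply, Pi.add_apply, Matrix.map_apply, snd_sum, DualNumber.snd_mul, fst_mul,
    snd_inl, fst_inl, mul_zero, zero_add, ← Finset.sum_add_distrib]
  refine Finset.sum_congr rfl fun _ _ => Finset.sum_congr rfl fun _ _ =>
    Finset.sum_congr rfl fun _ _ => ?_
  ring

omit [DecidableEq ι] in
/-- `inl` is multiplicative on matrices. [folklore] -/
private theorem map_inl_mul_map_inl (M N : Matrix ι ι ℂ) :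
    M.map (inl : ℂ → ℂ[ε]) * N.map (inl : ℂ → ℂ[ε]) = (M * N).map inl := by
  ext i j
  · simp only [Matrix.mul_apply, Matrix.map_apply, fst_sum, fst_mul, fst_inl]
  · simp only [Matrix.mul_apply, Matrix.map_apply, snd_sum, DualNumber.snd_mul, fst_inl, snd_inl,
      mul_zero, zero_mul, add_zero, Finset.sum_const_zero]

/-- **The Lie-algebra criterion for the mixed stabilizer** (Springer 4.3.3 (iii), as in
`finite_slStabilizer_of_hasTrivialSL3LieStabilizer` but for the group `GL × SL × SL`): if the mixed
infinitesimal stabilizer of `w ∈ ⊗³ℂ^ι` is zero, then `mixedStab w` is FINITE. If it is infinite,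
the Zariski closure of this set of points of `(Mat)³` has a positive-dimensional component `Z(𝔭)`;
at a stabilizer point `γ₀ ∈ Z(𝔭)` a non-zero tangent vector `(B₀,B₁,B₂)` kills the differentials
of the equations `((Y₀ ⊗ Y₁ ⊗ Y₂)·w)_{abc} − w_{abc}` and `det Y₁ − 1`, `det Y₂ − 1`, so
`(G₀⁻¹B₀, G₁⁻¹B₁, G₂⁻¹B₂)` is a non-zero triple in the mixed infinitesimal stabilizer.
[cite: SpringerLAG1998, Thm 4.3.3 (iii)] -/
theorem finite_mixedStab_of_hasTrivialMixedLieStabilizer (w : ι → ι → ι → ℂ)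
    (h : HasTrivialMixedLieStabilizer w) : (mixedStab w).Finite := by
  classical
  by_contra hinf
  let trip : GL ι ℂ × GL ι ℂ × GL ι ℂ → Fin 3 → Matrix ι ι ℂ :=
    fun g => ![(g.1 : Matrix ι ι ℂ), (g.2.1 : Matrix ι ι ℂ), (g.2.2 : Matrix ι ι ℂ)]
  let pt : GL ι ℂ × GL ι ℂ × GL ι ℂ → (Fin 3 × ι × ι → ℂ) := fun g p => trip g p.1 p.2.1 p.2.2
  have hdet : ∀ γ ∈ mixedStab w, ∀ s : Fin 3, s ≠ 0 → (trip γ s).det = 1 := by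
    intro γ hγ s hs
    rcases fin3_cases s with rfl | rfl | rfl
    · exact absurd rfl hs
    · exact hγ.2.1
    · exact hγ.2.2
  have hpt_inj : Function.Injective pt := by
    intro g g' hgg'
    have hc : ∀ s : Fin 3, trip g s = trip g' s := fun s =>
      Matrix.ext fun i j => congr_fun hgg' (s, i, j)
    refine Prod.ext ?_ (Prod.ext ?_ ?_)
    · exact Units.ext (hc 0)
    · exact Units.ext (hc 1)
    · exact Units.ext (hc 2)
  set S : Set (Fin 3 × ι × ι → ℂ) := pt '' mixedStab w with hS
  have hSinf : S.Infinite := Set.Infinite.image hpt_inj.injOn hinf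
  obtain ⟨𝔭, h𝔭min, hinf', -, hnotmax, -⟩ :=
    exists_mem_minimalPrimes_inter_infinite (k := ℂ) (K := ℂ) hSinf
  haveI h𝔭 : 𝔭.IsPrime := h𝔭min.1.1
  have hIS : MvPolynomial.vanishingIdeal ℂ S ≤ 𝔭 := h𝔭min.1.2
  obtain ⟨a, haS, ha𝔭⟩ := hinf'.nonempty
  obtain ⟨γ₀, hγ₀, rfl⟩ := haS
  have hγ₀w : actTensor (trip γ₀ 0) (trip γ₀ 1) (trip γ₀ 2) w = w := hγ₀.1
  have ha : ∀ p ∈ 𝔭, eval (pt γ₀) p = 0 := fun p hp => by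
    rw [← aeval_eq_eval]; exact (MvPolynomial.mem_zeroLocus_iff.mp ha𝔭) p hp
  -- the maximal ideal of `γ₀` in `ℂ[Y] ⧸ 𝔭` has positive height, so the tangent space is non-zero
  haveI : IsDomain (MvPolynomial (Fin 3 × ι × ι) ℂ ⧸ 𝔭) := Ideal.Quotient.isDomain 𝔭
  have hnf : ¬ IsField (MvPolynomial (Fin 3 × ι × ι) ℂ ⧸ 𝔭) := fun hF =>
    hnotmax ((Ideal.Quotient.maximal_ideal_iff_isField_quotient 𝔭).mpr hF)
  haveI := isMaximal_pointIdeal (pointOfZero 𝔭 (pt γ₀) ha)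
  have hbot : ⊥ < pointIdeal (pointOfZero 𝔭 (pt γ₀) ha) := Ideal.bot_lt_of_maximal _ hnf
  have hheight : (pointIdeal (pointOfZero 𝔭 (pt γ₀) ha)).height ≠ 0 := by
    rw [Ne, Ideal.height_eq_zero_iff_eq_bot]
    exact hbot.ne'
  have h1 : (1 : ℕ∞) ≤ Module.finrank ℂ (tangentSpaceAt 𝔭 (pt γ₀)) :=
    (Order.one_le_iff_ne_zero.mpr hheight).trans (height_le_finrank_tangentSpaceAt 𝔭 (pt γ₀) ha)
  have h1' : 0 < Module.finrank ℂ (tangentSpaceAt 𝔭 (pt γ₀)) := by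
    have : (1 : ℕ) ≤ Module.finrank ℂ (tangentSpaceAt 𝔭 (pt γ₀)) := by exact_mod_cast h1
    omega
  obtain ⟨v, hv⟩ := Module.finrank_pos_iff_exists_ne_zero.mp h1'
  -- the tangent vector as three matrices `Bₛ`; the inverses `Gₛ⁻¹`; `Nₛ = Gₛ⁻¹ Bₛ`
  let B : Fin 3 → Matrix ι ι ℂ := fun s => Matrix.of fun i j => (v : Fin 3 × ι × ι → ℂ) (s, i, j)
  let Gi : Fin 3 → Matrix ι ι ℂ :=
    ![((γ₀.1⁻¹ : GL ι ℂ) : Matrix ι ι ℂ), ((γ₀.2.1⁻¹ : GL ι ℂ) : Matrix ι ι ℂ),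
      ((γ₀.2.2⁻¹ : GL ι ℂ) : Matrix ι ι ℂ)]
  have hGiG : ∀ s, Gi s * trip γ₀ s = 1 := by
    intro s
    rcases fin3_cases s with rfl | rfl | rfl
    exacts [Units.inv_mul γ₀.1, Units.inv_mul γ₀.2.1, Units.inv_mul γ₀.2.2]
  have hGGi : ∀ s, trip γ₀ s * Gi s = 1 := by
    intro s
    rcases fin3_cases s with rfl | rfl | rfl
    exacts [Units.mul_inv γ₀.1, Units.mul_inv γ₀.2.1, Units.mul_inv γ₀.2.2]
  let N : Fin 3 → Matrix ι ι ℂ := fun s => Gi s * B s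
  have hGN : ∀ s, trip γ₀ s * N s = B s := fun s => by
    show trip γ₀ s * (Gi s * B s) = B s
    rw [← Matrix.mul_assoc, hGGi, Matrix.one_mul]
  -- the matrices of the dual-number point `γ₀ + ε B`
  have hfst : ∀ s, (Matrix.of fun i j => dualNumberPoint (pt γ₀) (v : Fin 3 × ι × ι → ℂ)
      (s, i, j)).map TrivSqZeroExt.fst = trip γ₀ s := by
    intro s; ext i j
    simp only [Matrix.map_apply, Matrix.of_apply, fst_dualNumberPoint]
    rfl
  have hsnd : ∀ s, (Matrix.of fun i j => dualNumberPoint (pt γ₀) (v : Fin 3 × ι × ι → ℂ)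
      (s, i, j)).map TrivSqZeroExt.snd = B s := by
    intro s; ext i j
    simp only [Matrix.map_apply, Matrix.of_apply, snd_dualNumberPoint]
    rfl
  -- (K1) the differentiated action equations, translated by `γ₀⁻¹`
  have K1 : actTensor (N 0) (1 : Matrix ι ι ℂ) (1 : Matrix ι ι ℂ) w +
      actTensor (1 : Matrix ι ι ℂ) (N 1) (1 : Matrix ι ι ℂ) w +
      actTensor (1 : Matrix ι ι ℂ) (1 : Matrix ι ι ℂ) (N 2) w = 0 := by
    have hD : actTensor (B 0) (trip γ₀ 1) (trip γ₀ 2) w + actTensor (trip γ₀ 0) (B 1) (trip γ₀ 2) w +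
        actTensor (trip γ₀ 0) (trip γ₀ 1) (B 2) w = 0 := by
      funext a b c
      let P : MvPolynomial (Fin 3 × ι × ι) ℂ :=
        actTensor (Matrix.of fun i j => (X (0, i, j) : MvPolynomial (Fin 3 × ι × ι) ℂ))
          (Matrix.of fun i j => (X (1, i, j) : MvPolynomial (Fin 3 × ι × ι) ℂ))
          (Matrix.of fun i j => (X (2, i, j) : MvPolynomial (Fin 3 × ι × ι) ℂ))
          (fun a b c => C (w a b c)) a b c - C (w a b c)
      have hPmem : P ∈ 𝔭 := by
        apply hIS
        rw [MvPolynomial.mem_vanishingIdeal_iff]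
        rintro _ ⟨γ, hγ, rfl⟩
        have hγw : actTensor (trip γ 0) (trip γ 1) (trip γ 2) w = w := hγ.1
        show aeval (pt γ) (actTensor _ _ _ _ a b c - C (w a b c)) = 0
        rw [map_sub, aeval_C, aeval_actTensor_X, Algebra.algebraMap_self_apply]
        have e : (fun a b c => algebraMap ℂ ℂ (w a b c)) = w := rfl
        rw [e]
        change actTensor (trip γ 0) (trip γ 1) (trip γ 2) w a b c - w a b c = 0
        rw [hγw, sub_self]
      have htan : linearFormOfVector (pt γ₀) (v : Fin 3 × ι × ι → ℂ) P = 0 :=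
        linearFormOfVector_eq_zero 𝔭 (pt γ₀) v _ hPmem
      have hε := snd_aeval_dualNumberPoint (pt γ₀) (v : Fin 3 × ι × ι → ℂ) P
      rw [htan] at hε
      change TrivSqZeroExt.snd (aeval (dualNumberPoint (pt γ₀) (v : Fin 3 × ι × ι → ℂ))
        (actTensor _ _ _ _ a b c - C (w a b c))) = 0 at hε
      rw [map_sub, aeval_C, aeval_actTensor_X, TrivSqZeroExt.algebraMap_eq_inl, snd_sub, snd_inl,
        sub_zero] at hε
      rw [snd_actTensor_inl, hsnd 0, hsnd 1, hsnd 2, hfst 0, hfst 1, hfst 2] at hε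
      rw [hε]
      rfl
    have h2 := congrArg (actTensor (Gi 0) (Gi 1) (Gi 2)) hD
    rw [actTensor_zero, actTensor_add_tensor, actTensor_add_tensor, actTensor_actTensor,
      actTensor_actTensor, actTensor_actTensor, hGiG 0, hGiG 1, hGiG 2] at h2
    exact h2
  -- (K2) the differentiated determinant equations `det Yₛ = 1`, `s = 1, 2`: `tr Nₛ = 0`
  have K2 : ∀ s : Fin 3, s ≠ 0 → (N s).trace = 0 := by
    intro s hs
    let Q : MvPolynomial (Fin 3 × ι × ι) ℂ :=
      (Matrix.of fun i j => (X (s, i, j) : MvPolynomial (Fin 3 × ι × ι) ℂ)).det - 1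
    have hmapQ : ∀ {R : Type} [CommRing R] [Algebra ℂ R] (y : Fin 3 × ι × ι → R),
        aeval y Q = (Matrix.of fun i j => y (s, i, j)).det - 1 := by
      intro R _ _ y
      show aeval y ((Matrix.of fun i j => (X (s, i, j) : MvPolynomial (Fin 3 × ι × ι) ℂ)).det - 1) = _
      rw [map_sub, map_one, AlgHom.map_det, AlgHom.mapMatrix_apply]
      congr 2
      ext i j
      simp only [Matrix.map_apply, Matrix.of_apply, aeval_X]
    have hQmem : Q ∈ 𝔭 := by
      apply hIS
      rw [MvPolynomial.mem_vanishingIdeal_iff]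
      rintro _ ⟨γ, hγ, rfl⟩
      rw [hmapQ]
      change (trip γ s).det - 1 = 0
      rw [hdet γ hγ s hs, sub_self]
    have htan : linearFormOfVector (pt γ₀) (v : Fin 3 × ι × ι → ℂ) Q = 0 :=
      linearFormOfVector_eq_zero 𝔭 (pt γ₀) v _ hQmem
    have hε := snd_aeval_dualNumberPoint (pt γ₀) (v : Fin 3 × ι × ι → ℂ) Q
    rw [htan, hmapQ] at hε
    -- `γ₀ + ε B = G (1 + ε N)` in the `s`-th component
    have hGε : (Matrix.of fun i j => dualNumberPoint (pt γ₀) (v : Fin 3 × ι × ι → ℂ) (s, i, j)) =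
        (trip γ₀ s).map inl * (1 + (ε : ℂ[ε]) • (N s).map inl) := by
      rw [Matrix.mul_add, Matrix.mul_one, Matrix.mul_smul, map_inl_mul_map_inl, hGN]
      ext i j
      · simp only [Matrix.of_apply, dualNumberPoint, Matrix.add_apply, Matrix.map_apply,
          Matrix.smul_apply, smul_eq_mul, fst_add, fst_inl, fst_inr, fst_mul, fst_eps, zero_mul,
          add_zero]
        rfl
      · simp only [Matrix.of_apply, dualNumberPoint, Matrix.add_apply, Matrix.map_apply,
          Matrix.smul_apply, smul_eq_mul, snd_add, snd_inl, snd_inr, DualNumber.snd_mul, fst_eps,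
          snd_eps, fst_inl, zero_mul, one_mul, zero_add]
        rfl
    have hdet1 : ((trip γ₀ s).map inl : Matrix ι ι ℂ[ε]).det = 1 := by
      have h := RingHom.map_det (TrivSqZeroExt.inlHom ℂ ℂ) (trip γ₀ s)
      rw [hdet γ₀ hγ₀ s hs, map_one] at h
      rw [h]
      rfl
    rw [hGε, Matrix.det_mul, hdet1, one_mul, Matrix.det_one_add_smul, sq, eps_mul_eps, mul_zero,
      add_zero, add_sub_cancel_left, DualNumber.snd_mul, snd_eps, fst_eps, mul_one, mul_zero,
      add_zero] at hε
    rw [Matrix.trace, fst_sum] at hε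
    rw [Matrix.trace, ← hε]
    refine Finset.sum_congr rfl fun i _ => ?_
    simp only [Matrix.diag_apply, Matrix.map_apply, fst_inl]
  -- conclusion: `N = 0`, hence `B = 0`, hence `v = 0`
  obtain ⟨hN0, hN1, hN2⟩ := h (N 0) (N 1) (N 2) (K2 1 (by decide)) (K2 2 (by decide)) K1
  have hN : ∀ s, N s = 0 := by
    intro s
    rcases fin3_cases s with rfl | rfl | rfl
    exacts [hN0, hN1, hN2]
  apply hv
  apply Subtype.ext
  funext p
  obtain ⟨s, i, j⟩ := p
  have hB : B s = 0 := by rw [← hGN s, hN s, Matrix.mul_zero]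
  have hij := congr_fun (congr_fun hB i) j
  change (v : Fin 3 × ι × ι → ℂ) (s, i, j) = 0 at hij
  rw [hij]
  rfl

/-- Hence ONE tensor with zero mixed infinitesimal stabilizer gives: **almost all `w ∈ ⊗³ℂ^ι`
have a finite mixed stabilizer.** [cite: BurgisserIkenmeyer2017, Thm. 4.2 (proof)] -/
theorem isZariskiGenericTensor_finite_mixedStab_of_exists (w₀ : ι → ι → ι → ℂ)
    (h₀ : HasTrivialMixedLieStabilizer w₀) :
    IsZariskiGenericTensor fun w : ι → ι → ι → ℂ => (mixedStab w).Finite :=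
  (isZariskiGenericTensor_hasTrivialMixedLieStabilizer_of_exists w₀ h₀).mono
    fun w hw => finite_mixedStab_of_hasTrivialMixedLieStabilizer w hw

end Finite

/-! ### The witness: the full infinitesimal stabilizer of `bandWitness n` is the torus algebra -/

section Witness

variable (n : ℕ)

/-- **The infinitesimal stabilizer of the witness `w_m` (`m = n + 4`) in `𝔤𝔩³` is the torus
algebra**: if `(X ⊗ 1 ⊗ 1 + 1 ⊗ Y ⊗ 1 + 1 ⊗ 1 ⊗ Z)·w_m = 0` then `X = ξ·1`, `Z = ζ·1`,
`Y = −(ξ+ζ)·1` with `ξ = X₀₀`, `ζ = Z₀₀` (the elimination of `hasTrivialSL3LieStabilizer_bandWitness`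
without the trace hypotheses). [cite: BurgisserIkenmeyer2017, §4.1 eq. (4.1) (infinitesimal form)] -/
theorem lieKernel_bandWitness (X Y Z : Matrix (Fin (n + 4)) (Fin (n + 4)) ℂ)
    (hL : actTensor X (1 : Matrix (Fin (n + 4)) (Fin (n + 4)) ℂ) (1 : Matrix (Fin (n + 4)) (Fin (n + 4)) ℂ)
          (bandWitness n) +
        actTensor (1 : Matrix (Fin (n + 4)) (Fin (n + 4)) ℂ) Y (1 : Matrix (Fin (n + 4)) (Fin (n + 4)) ℂ)
          (bandWitness n) +
        actTensor (1 : Matrix (Fin (n + 4)) (Fin (n + 4)) ℂ) (1 : Matrix (Fin (n + 4)) (Fin (n + 4)) ℂ) Z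
          (bandWitness n) = 0) :
    X = X 0 0 • (1 : Matrix (Fin (n + 4)) (Fin (n + 4)) ℂ) ∧
      Z = Z 0 0 • (1 : Matrix (Fin (n + 4)) (Fin (n + 4)) ℂ) ∧
      Y = -(X 0 0 + Z 0 0) • (1 : Matrix (Fin (n + 4)) (Fin (n + 4)) ℂ) := by
  -- the shift `σ b = b + 1` and its elementary properties (`1, 2, 3 ≠ 0` in `ℤ/(n+4)`)
  let σ : Fin (n + 4) → Fin (n + 4) := fun b => b + 1
  have hv1 : ((1 : Fin (n + 4)) : ℕ) = 1 := Fin.val_one _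
  have hv2 : (((1 : Fin (n + 4)) + 1 : Fin (n + 4)) : ℕ) = 2 := by
    rw [Fin.val_add, hv1, Nat.mod_eq_of_lt (by omega)]
  have hv3 : (((1 : Fin (n + 4)) + 1 + 1 : Fin (n + 4)) : ℕ) = 3 := by
    rw [Fin.val_add, hv2, hv1, Nat.mod_eq_of_lt (by omega)]
  have h1 : (1 : Fin (n + 4)) ≠ 0 := fun h => by
    have := congrArg Fin.val h; rw [hv1, Fin.val_zero] at this; omega
  have h2 : (1 : Fin (n + 4)) + 1 ≠ 0 := fun h => by
    have := congrArg Fin.val h; rw [hv2, Fin.val_zero] at this; omega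
  have h3 : (1 : Fin (n + 4)) + 1 + 1 ≠ 0 := fun h => by
    have := congrArg Fin.val h; rw [hv3, Fin.val_zero] at this; omega
  have σinj : ∀ x y : Fin (n + 4), σ x = σ y ↔ x = y := fun x y => add_left_inj 1
  have σ1 : ∀ x : Fin (n + 4), σ x ≠ x := fun x h => h1 (by
    have : x + 1 = x + 0 := by rw [add_zero]; exact h
    exact add_left_cancel this)
  have σ2 : ∀ x : Fin (n + 4), σ (σ x) ≠ x := fun x h => h2 (by
    have : x + (1 + 1) = x + 0 := by rw [add_zero, ← add_assoc]; exact h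
    exact add_left_cancel this)
  have σ3 : ∀ x : Fin (n + 4), σ (σ (σ x)) ≠ x := fun x h => h3 (by
    have : x + (1 + 1 + 1) = x + 0 := by rw [add_zero, ← add_assoc, ← add_assoc]; exact h
    exact add_left_cancel this)
  have σ1' : ∀ x : Fin (n + 4), x ≠ σ x := fun x h => σ1 x h.symm
  have σ2' : ∀ x : Fin (n + 4), x ≠ σ (σ x) := fun x h => σ2 x h.symm
  have σ3' : ∀ x : Fin (n + 4), x ≠ σ (σ (σ x)) := fun x h => σ3 x h.symm
  -- the nine-term equations, in `σ`-form
  have E : ∀ a b c : Fin (n + 4),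
      (if b = c then X a b else 0) + (if c = σ b then X a b else 0) +
          (if c = b then X a (σ b) else 0) +
        ((if a = c then Y b a else 0) + (if c = σ a then Y b a else 0) +
          (if a = σ c then Y b c else 0)) +
        ((if a = b then Z c b else 0) + (if a = b then Z c (σ b) else 0) +
          (if a = σ b then Z c b else 0)) = 0 := by
    intro a b c
    have h := congr_fun (congr_fun (congr_fun hL a) b) c
    rw [lieAction_bandWitness_apply] at h
    exact h
  -- Step 1: the three bands
  have bX : ∀ a b, a ≠ b → a ≠ σ b → a ≠ σ (σ b) → X a b = 0 := by
    intro a b hab hab1 hab2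
    have e := E a b (σ b)
    simp only [σinj, σ1, σ1', if_false, if_true, zero_add, add_zero, hab, Ne.symm hab, hab1,
      hab2] at e
    exact e
  have bY : ∀ b a, b ≠ a → b ≠ σ a → a ≠ σ b → Y b a = 0 := by
    intro b a hba hba1 hab1
    have e := E a b (σ a)
    simp only [σinj, σ1', σ2', if_false, if_true, zero_add, add_zero, Ne.symm hba, hba1,
      Ne.symm hba1, hab1] at e
    exact e
  have bZ : ∀ c b, c ≠ b → c ≠ σ b → c ≠ σ (σ b) → Z c b = 0 := by
    intro c b hcb hcb1 hcb2
    have e := E (σ b) b c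
    simp only [σinj, σ1, if_false, if_true, zero_add, add_zero, hcb, Ne.symm hcb, hcb1,
      Ne.symm hcb1, hcb2] at e
    exact e
  -- handy out-of-band entries
  have X03 : ∀ b, X (σ (σ (σ b))) b = 0 := fun b =>
    bX _ _ (σ3 b) (by rw [Ne, σinj]; exact σ2 b) (by rw [Ne, σinj, σinj]; exact σ1 b)
  have X01 : ∀ b, X b (σ b) = 0 := fun b =>
    bX _ _ (σ1' b) (σ2' b) (σ3' b)
  have Z03 : ∀ b, Z (σ (σ (σ b))) b = 0 := fun b =>
    bZ _ _ (σ3 b) (by rw [Ne, σinj]; exact σ2 b) (by rw [Ne, σinj, σinj]; exact σ1 b)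
  have Z01 : ∀ b, Z b (σ b) = 0 := fun b =>
    bZ _ _ (σ1' b) (σ2' b) (σ3' b)
  -- Step 2: `Y_{b+1,b} = 0` from the pattern `(b, b+1, b)`
  have Y10 : ∀ b, Y (σ b) b = 0 := by
    intro b
    have e := E b (σ b) b
    simp only [σ1, σ1', σ2', if_false, if_true, zero_add, add_zero] at e
    exact e
  -- Step 3: `Z_{b+2,b} = 0` and `X_{b+2,b} = 0`
  have Z2 : ∀ b, Z (σ (σ b)) b = 0 := by
    intro b'
    have key : ∀ b, Z (σ (σ (σ b))) (σ b) = 0 := by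
      intro b
      have e := E b b (σ (σ (σ b)))
      have hY : (if b = σ (σ (σ (σ b))) then Y b (σ (σ (σ b))) else 0) = 0 := by
        split_ifs with h
        · have : Y (σ (σ (σ (σ b)))) (σ (σ (σ b))) = 0 := Y10 _
          rwa [← h] at this
        · rfl
      simp only [σinj, σ1', σ2, σ3, σ3', if_false, if_true, zero_add, add_zero, hY, Z03] at e
      exact e
    have := key (b' - 1)
    have e1 : σ (b' - 1) = b' := sub_add_cancel b' 1
    rw [e1] at this
    exact this
  have X2 : ∀ b, X (σ (σ b)) b = 0 := by
    intro b'
    have key : ∀ b, X (σ (σ (σ b))) (σ b) = 0 := by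
      intro b
      have e := E (σ (σ (σ b))) b b
      have hY : (if b = σ (σ (σ (σ b))) then Y b (σ (σ (σ b))) else 0) = 0 := by
        split_ifs with h
        · have : Y (σ (σ (σ (σ b)))) (σ (σ (σ b))) = 0 := Y10 _
          rwa [← h] at this
        · rfl
      simp only [σinj, σ1', σ2, σ3, if_false, if_true, zero_add, add_zero, hY, X03] at e
      exact e
    have := key (b' - 1)
    have e1 : σ (b' - 1) = b' := sub_add_cancel b' 1
    rw [e1] at this
    exact this
  -- Step 4: `Y_{b,b+1} = 0`; then `X_{b+1,b} = 0`, `Z_{b+1,b} = 0`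
  have Y01 : ∀ b, Y b (σ b) = 0 := by
    intro b
    have e := E (σ (σ b)) b (σ b)
    simp only [σinj, σ1, σ1', σ2, σ2', if_false, if_true, zero_add, add_zero, X2] at e
    exact e
  have X1 : ∀ b, X (σ b) b = 0 := by
    intro b'
    have key : ∀ b, X (σ (σ b)) (σ b) = 0 := by
      intro b
      have e := E (σ (σ b)) b b
      simp only [σinj, σ1, σ1', σ2, σ3', if_false, if_true, zero_add, add_zero, X2] at e
      exact e
    have := key (b' - 1)
    have e1 : σ (b' - 1) = b' := sub_add_cancel b' 1
    rw [e1] at this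
    exact this
  have Z1 : ∀ b, Z (σ b) b = 0 := by
    intro b'
    have key : ∀ b, Z (σ (σ b)) (σ b) = 0 := by
      intro b
      have e := E b b (σ (σ b))
      simp only [σinj, σ1, σ1', σ2, σ2', σ3', if_false, if_true, zero_add, add_zero, Z2] at e
      exact e
    have := key (b' - 1)
    have e1 : σ (b' - 1) = b' := sub_add_cancel b' 1
    rw [e1] at this
    exact this
  -- Step 5: the diagonals are constant
  have dZ : ∀ b, Z (σ b) (σ b) = Z b b := by
    intro b
    have e0 := E b b b
    have e1 := E b b (σ b)
    simp only [σ1, σ1', σ2', if_false, if_true, zero_add, add_zero, X01, Z01, Z1] at e0 e1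
    linear_combination e1 - e0
  have dX : ∀ b, X (σ b) (σ b) = X b b := by
    intro b
    have e0 := E b b b
    have e1 := E (σ b) b b
    simp only [σ1, σ1', σ2', if_false, if_true, zero_add, add_zero, X01, Z01, X1] at e0 e1
    linear_combination e1 - e0
  have dY : ∀ b, Y b b = -(X b b + Z b b) := by
    intro b
    have e0 := E b b b
    simp only [σ1', if_false, if_true, add_zero, X01, Z01] at e0
    linear_combination e0
  have cX : ∀ b, X b b = X 0 0 := by
    intro b
    induction b using Fin.induction with
    | zero => rfl
    | succ i ih => rw [← Fin.coeSucc_eq_succ]; exact (dX _).trans ih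
  have cZ : ∀ b, Z b b = Z 0 0 := by
    intro b
    induction b using Fin.induction with
    | zero => rfl
    | succ i ih => rw [← Fin.coeSucc_eq_succ]; exact (dZ _).trans ih
  -- assembly
  refine ⟨?_, ?_, ?_⟩
  · ext a b
    rw [Matrix.smul_apply, Matrix.one_apply, smul_eq_mul, mul_ite, mul_one, mul_zero]
    by_cases h0 : a = b
    · rw [if_pos h0, h0]; exact cX b
    rw [if_neg h0]
    by_cases h1' : a = σ b
    · rw [h1']; exact X1 b
    by_cases h2' : a = σ (σ b)
    · rw [h2']; exact X2 b
    exact bX a b h0 h1' h2'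
  · ext c b
    rw [Matrix.smul_apply, Matrix.one_apply, smul_eq_mul, mul_ite, mul_one, mul_zero]
    by_cases h0 : c = b
    · rw [if_pos h0, h0]; exact cZ b
    rw [if_neg h0]
    by_cases h1' : c = σ b
    · rw [h1']; exact Z1 b
    by_cases h2' : c = σ (σ b)
    · rw [h2']; exact Z2 b
    exact bZ c b h0 h1' h2'
  · ext b a
    rw [Matrix.smul_apply, Matrix.one_apply, smul_eq_mul, mul_ite, mul_one, mul_zero]
    by_cases h0 : b = a
    · rw [if_pos h0, h0, dY, cX, cZ]
    rw [if_neg h0]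
    by_cases h1' : b = σ a
    · rw [h1']; exact Y10 a
    by_cases h2' : a = σ b
    · rw [h2']; exact Y01 b
    exact bY b a h0 h1' h2'

/-- **The witness has zero mixed infinitesimal stabilizer**: `tr Z = 0` kills `ζ`, then
`tr Y = 0` kills `ξ`. [cite: BurgisserIkenmeyer2017, Thm. 4.2 (proof)] -/
theorem hasTrivialMixedLieStabilizer_bandWitness : HasTrivialMixedLieStabilizer (bandWitness n) := by
  intro X Y Z hY hZ hL
  obtain ⟨hX', hZ', hY'⟩ := lieKernel_bandWitness n X Y Z hL
  have hcard : ((n + 4 : ℕ) : ℂ) ≠ 0 := Nat.cast_ne_zero.mpr (by omega)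
  have htr : ∀ t : ℂ, (t • (1 : Matrix (Fin (n + 4)) (Fin (n + 4)) ℂ)).trace = ((n + 4 : ℕ) : ℂ) * t := by
    intro t
    rw [Matrix.trace_smul, Matrix.trace_one, Fintype.card_fin, smul_eq_mul, mul_comm]
  have Z00 : Z 0 0 = 0 := by
    rw [hZ', htr] at hZ
    exact (mul_eq_zero.mp hZ).resolve_left hcard
  have X00 : X 0 0 = 0 := by
    rw [hY', htr, Z00, add_zero, mul_neg, neg_eq_zero] at hY
    exact (mul_eq_zero.mp hY).resolve_left hcard
  refine ⟨?_, ?_, ?_⟩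
  · rw [hX', X00, zero_smul]
  · rw [hY', X00, Z00, add_zero, neg_zero, zero_smul]
  · rw [hZ', Z00, zero_smul]

/-- **For every `m ≥ 4`, almost all `w ∈ ⊗³ℂ^m` have a finite mixed stabilizer.**
[cite: BurgisserIkenmeyer2017, Thm. 4.2 (proof)] -/
theorem isZariskiGenericTensor_finite_mixedStab {m : ℕ} (hm : 4 ≤ m) :
    IsZariskiGenericTensor fun w : Fin m → Fin m → Fin m → ℂ => (mixedStab w).Finite := by
  obtain ⟨n, rfl⟩ : ∃ n, m = n + 4 := ⟨m - 4, by omega⟩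
  exact isZariskiGenericTensor_finite_mixedStab_of_exists _ (hasTrivialMixedLieStabilizer_bandWitness n)

end Witness

/-! ### Assembly: finite order, diagonalisation, charts, count -/

section Assembly

/-- In a group, an element all of whose powers lie in a finite set has finite order. [folklore] -/
private theorem exists_pow_eq_one_of_forall_pow_mem {G : Type*} [Group G] {S : Set G}
    (hS : S.Finite) {x : G} (hx : ∀ j : ℕ, x ^ j ∈ S) : ∃ n : ℕ, 0 < n ∧ x ^ n = 1 := by
  haveI := hS.to_subtype
  obtain ⟨a, b, hab, h⟩ :=
    Finite.exists_ne_map_eq_of_infinite (fun j : ℕ => (⟨x ^ j, hx j⟩ : S))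
  have h' : x ^ a = x ^ b := congrArg Subtype.val h
  rcases Nat.lt_or_gt_of_ne hab with hlt | hlt
  · refine ⟨b - a, Nat.sub_pos_of_lt hlt, ?_⟩
    have e : x ^ a * x ^ (b - a) = x ^ a * 1 := by
      rw [← pow_add, Nat.add_sub_cancel' hlt.le, mul_one]; exact h'.symm
    exact mul_left_cancel e
  · refine ⟨a - b, Nat.sub_pos_of_lt hlt, ?_⟩
    have e : x ^ b * x ^ (a - b) = x ^ b * 1 := by
      rw [← pow_add, Nat.add_sub_cancel' hlt.le, mul_one]; exact h'
    exact mul_left_cancel e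

variable {m : ℕ}

/-- From `(t • g) P = P diag(c)` to `g P = P diag(t⁻¹ • c)` (`t ≠ 0`). [folklore] -/
private theorem mul_eq_mul_diagonal_of_smul {t : ℂ} (ht : t ≠ 0) {g P : Matrix (Fin m) (Fin m) ℂ}
    {c : Fin m → ℂ} (h : (t • g) * P = P * Matrix.diagonal c) :
    g * P = P * Matrix.diagonal (t⁻¹ • c) := by
  rw [Matrix.diagonal_smul, Matrix.mul_smul, ← h, smul_mul_assoc, smul_smul, inv_mul_cancel₀ ht,
    one_smul]

/-- The eigenvalues of a diagonalisable invertible matrix are nonzero. [folklore] -/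
private theorem eigen_ne_zero {g P : Matrix (Fin m) (Fin m) ℂ} {c : Fin m → ℂ} (hg : IsUnit g.det)
    (hP : IsUnit P.det) (h : g * P = P * Matrix.diagonal c) (i : Fin m) : c i ≠ 0 := by
  intro hi
  have hdet := congrArg Matrix.det h
  rw [Matrix.det_mul, Matrix.det_mul, Matrix.det_diagonal,
    Finset.prod_eq_zero (Finset.mem_univ i) hi, mul_zero] at hdet
  exact (mul_ne_zero hg.ne_zero hP.ne_zero) hdet

/-- A matrix conjugate to a scalar is that scalar: `g P = P (α • 1)` gives `g = α • 1`. [folklore] -/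
private theorem eq_smul_one_of_constant {g P : Matrix (Fin m) (Fin m) ℂ} {c : Fin m → ℂ} (hP : IsUnit P.det)
    (h : g * P = P * Matrix.diagonal c) {α : ℂ} (hc : ∀ i, c i = α) :
    g = α • (1 : Matrix (Fin m) (Fin m) ℂ) := by
  have hd : Matrix.diagonal c = α • (1 : Matrix (Fin m) (Fin m) ℂ) := by
    rw [← Matrix.diagonal_one, ← Matrix.diagonal_smul]
    congr 1
    funext i
    rw [Pi.smul_apply, smul_eq_mul, mul_one, hc i]
  calc g = g * P * P⁻¹ := by rw [Matrix.mul_assoc, Matrix.mul_nonsing_inv P hP, Matrix.mul_one]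
    _ = α • (1 : Matrix (Fin m) (Fin m) ℂ) := by
      rw [h, hd, Matrix.mul_smul, Matrix.mul_one, smul_mul_assoc, Matrix.mul_nonsing_inv P hP]

/-- **Pointwise assembly.** Let `m ≥ 4` and `w ∈ ⊗³ℂ^m` with `w ≠ 0`, finite mixed stabilizer,
and outside the image of every triple pivot chart with fewer than `m³` parameters. Then `w` has a
trivial stabilizer. [cite: BurgisserIkenmeyer2017, Thm. 4.2 (proof)] -/
theorem hasTrivialTensorStabilizer_of_finite_mixedStab (hm : 4 ≤ m)
    {w : Fin m → Fin m → Fin m → ℂ} (hw0 : w ≠ 0) (hfin : (mixedStab w).Finite)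
    (havoid : ∀ (blk₁ ρ₁ blk₂ ρ₂ blk₃ ρ₃ : Fin m → Fin m) (S : Finset (Fin m × Fin m × Fin m)),
      Fintype.card (chartVars blk₁ ρ₁ ⊕ chartVars blk₂ ρ₂ ⊕ chartVars blk₃ ρ₃) + S.card < m ^ 3 →
      w ∉ tensorChartImage ((chartMatrix ℂ blk₁ ρ₁).map (rename Sum.inl))
        ((chartMatrix ℂ blk₂ ρ₂).map (rename (Sum.inr ∘ Sum.inl)))
        ((chartMatrix ℂ blk₃ ρ₃).map (rename (Sum.inr ∘ Sum.inr))) S) :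
    HasTrivialTensorStabilizer w := by
  classical
  intro g hg
  rw [mem_tensorStab_iff] at hg
  have hm0 : 0 < m := by omega
  -- invertibility of the components
  have hu : ∀ u : GL (Fin m) ℂ, IsUnit (u : Matrix (Fin m) (Fin m) ℂ).det := fun u =>
    (Matrix.isUnit_iff_isUnit_det _).mp (Units.isUnit u)
  -- Step R: rescale into the mixed stabilizer
  obtain ⟨t₂, ht₂⟩ := IsAlgClosed.exists_pow_nat_eq ((g.2.1 : Matrix (Fin m) (Fin m) ℂ).det⁻¹) hm0
  obtain ⟨t₃, ht₃⟩ := IsAlgClosed.exists_pow_nat_eq ((g.2.2 : Matrix (Fin m) (Fin m) ℂ).det⁻¹) hm0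
  have ht₂0 : t₂ ≠ 0 := fun h0 => by
    rw [h0, zero_pow hm0.ne'] at ht₂; exact inv_ne_zero (hu g.2.1).ne_zero ht₂.symm
  have ht₃0 : t₃ ≠ 0 := fun h0 => by
    rw [h0, zero_pow hm0.ne'] at ht₃; exact inv_ne_zero (hu g.2.2).ne_zero ht₃.symm
  set t₁ : ℂ := (t₂ * t₃)⁻¹ with ht₁
  have ht₁0 : t₁ ≠ 0 := inv_ne_zero (mul_ne_zero ht₂0 ht₃0)
  have ht123 : t₁ * t₂ * t₃ = 1 := by
    rw [ht₁, mul_assoc, inv_mul_cancel₀ (mul_ne_zero ht₂0 ht₃0)]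
  have hdet_smul : ∀ (t : ℂ) (u : GL (Fin m) ℂ),
      (t • (u : Matrix (Fin m) (Fin m) ℂ)).det = t ^ m * (u : Matrix (Fin m) (Fin m) ℂ).det := by
    intro t u; rw [Matrix.det_smul, Fintype.card_fin]
  have hne : ∀ {t : ℂ} (ht : t ≠ 0) (u : GL (Fin m) ℂ),
      (t • (u : Matrix (Fin m) (Fin m) ℂ)).det ≠ 0 := fun {t} ht u => by
    rw [hdet_smul]; exact mul_ne_zero (pow_ne_zero _ ht) (hu u).ne_zero
  let g₁' : GL (Fin m) ℂ := Matrix.GeneralLinearGroup.mkOfDetNeZero _ (hne ht₁0 g.1)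
  let g₂' : GL (Fin m) ℂ := Matrix.GeneralLinearGroup.mkOfDetNeZero _ (hne ht₂0 g.2.1)
  let g₃' : GL (Fin m) ℂ := Matrix.GeneralLinearGroup.mkOfDetNeZero _ (hne ht₃0 g.2.2)
  have hc₁ : (g₁' : Matrix (Fin m) (Fin m) ℂ) = t₁ • (g.1 : Matrix (Fin m) (Fin m) ℂ) := rfl
  have hc₂ : (g₂' : Matrix (Fin m) (Fin m) ℂ) = t₂ • (g.2.1 : Matrix (Fin m) (Fin m) ℂ) := rfl
  have hc₃ : (g₃' : Matrix (Fin m) (Fin m) ℂ) = t₃ • (g.2.2 : Matrix (Fin m) (Fin m) ℂ) := rfl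
  have hmem : ((g₁', g₂', g₃') : GL (Fin m) ℂ × GL (Fin m) ℂ × GL (Fin m) ℂ) ∈ mixedStab w := by
    refine ⟨?_, ?_, ?_⟩
    · change actTensor (g₁' : Matrix (Fin m) (Fin m) ℂ) (g₂' : Matrix (Fin m) (Fin m) ℂ)
        (g₃' : Matrix (Fin m) (Fin m) ℂ) w = w
      rw [hc₁, hc₂, hc₃, actTensor_smul_fst, actTensor_smul_snd, actTensor_smul_thd, smul_smul,
        smul_smul, hg, ht123, one_smul]
    · change (g₂' : Matrix (Fin m) (Fin m) ℂ).det = 1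
      rw [hc₂, hdet_smul, ht₂, inv_mul_cancel₀ (hu g.2.1).ne_zero]
    · change (g₃' : Matrix (Fin m) (Fin m) ℂ).det = 1
      rw [hc₃, hdet_smul, ht₃, inv_mul_cancel₀ (hu g.2.2).ne_zero]
  -- finite order in the mixed stabilizer
  obtain ⟨N, hN, hpow⟩ := exists_pow_eq_one_of_forall_pow_mem hfin (pow_mem_mixedStab hmem)
  have hp₁ : (t₁ • (g.1 : Matrix (Fin m) (Fin m) ℂ)) ^ N = 1 := by
    rw [← hc₁, ← Units.val_pow_eq_pow_val]
    have : (((g₁', g₂', g₃') : GL (Fin m) ℂ × GL (Fin m) ℂ × GL (Fin m) ℂ) ^ N).1 = 1 := by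
      rw [hpow]; rfl
    rw [Prod.pow_fst] at this
    rw [this, Units.val_one]
  have hp₂ : (t₂ • (g.2.1 : Matrix (Fin m) (Fin m) ℂ)) ^ N = 1 := by
    rw [← hc₂, ← Units.val_pow_eq_pow_val]
    have : (((g₁', g₂', g₃') : GL (Fin m) ℂ × GL (Fin m) ℂ × GL (Fin m) ℂ) ^ N).2.1 = 1 := by
      rw [hpow]; rfl
    rw [Prod.pow_snd, Prod.pow_fst] at this
    rw [this, Units.val_one]
  have hp₃ : (t₃ • (g.2.2 : Matrix (Fin m) (Fin m) ℂ)) ^ N = 1 := by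
    rw [← hc₃, ← Units.val_pow_eq_pow_val]
    have : (((g₁', g₂', g₃') : GL (Fin m) ℂ × GL (Fin m) ℂ × GL (Fin m) ℂ) ^ N).2.2 = 1 := by
      rw [hpow]; rfl
    rw [Prod.pow_snd, Prod.pow_snd] at this
    rw [this, Units.val_one]
  -- diagonalise the three components
  obtain ⟨P₁, c₁, hP₁, hd₁⟩ :=
    Literature.RepresentationTheory.ClassicalInvariants.LinearSubstitution.exists_mul_eq_mul_diagonal_of_pow_eq_one
      hN hp₁
  obtain ⟨P₂, c₂, hP₂, hd₂⟩ :=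
    Literature.RepresentationTheory.ClassicalInvariants.LinearSubstitution.exists_mul_eq_mul_diagonal_of_pow_eq_one
      hN hp₂
  obtain ⟨P₃, c₃, hP₃, hd₃⟩ :=
    Literature.RepresentationTheory.ClassicalInvariants.LinearSubstitution.exists_mul_eq_mul_diagonal_of_pow_eq_one
      hN hp₃
  have h₁ := mul_eq_mul_diagonal_of_smul ht₁0 hd₁
  have h₂ := mul_eq_mul_diagonal_of_smul ht₂0 hd₂
  have h₃ := mul_eq_mul_diagonal_of_smul ht₃0 hd₃
  set a : Fin m → ℂ := t₁⁻¹ • c₁ with ha_def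
  set b : Fin m → ℂ := t₂⁻¹ • c₂ with hb_def
  set c : Fin m → ℂ := t₃⁻¹ • c₃ with hc_def
  have ha : ∀ i, a i ≠ 0 := eigen_ne_zero (hu g.1) hP₁ h₁
  have hb : ∀ j, b j ≠ 0 := eigen_ne_zero (hu g.2.1) hP₂ h₂
  have hc : ∀ j, c j ≠ 0 := eigen_ne_zero (hu g.2.2) hP₃ h₃
  by_cases hnc : (∃ i j, a i ≠ a j) ∨ (∃ i j, b i ≠ b j) ∨ (∃ i j, c i ≠ c j)
  · -- non-scalar: `w` lies in a small triple chart — contradiction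
    exfalso
    obtain ⟨ρ₁, ρ₂, ρ₃, hρ₁, hρ₂, hρ₃, hwmem⟩ := exists_tensorEigenChart hP₁ hP₂ hP₃ h₁ h₂ h₃ hg
    have hlt : Fintype.card (chartVars (blkOf a) ρ₁ ⊕ chartVars (blkOf b) ρ₂ ⊕ chartVars (blkOf c) ρ₃)
        + (fixSupport a b c).card < m ^ 3 := by
      rw [card_tripleChartVars hρ₁ hρ₂ hρ₃]
      exact card_nePairs_add_card_fixSupport_lt hm ha hb hc hnc
    exact havoid (blkOf a) ρ₁ (blkOf b) ρ₂ (blkOf c) ρ₃ (fixSupport a b c) hlt hwmem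
  · -- scalar
    have hca : ∀ i j, a i = a j := fun i j => by
      by_contra h'; exact hnc (Or.inl ⟨i, j, h'⟩)
    have hcb : ∀ i j, b i = b j := fun i j => by
      by_contra h'; exact hnc (Or.inr (Or.inl ⟨i, j, h'⟩))
    have hcc : ∀ i j, c i = c j := fun i j => by
      by_contra h'; exact hnc (Or.inr (Or.inr ⟨i, j, h'⟩))
    have i₀ : Fin m := ⟨0, hm0⟩
    have hg₁ : (g.1 : Matrix (Fin m) (Fin m) ℂ) = a i₀ • (1 : Matrix (Fin m) (Fin m) ℂ) :=
      eq_smul_one_of_constant hP₁ h₁ fun i => hca i i₀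
    have hg₂ : (g.2.1 : Matrix (Fin m) (Fin m) ℂ) = b i₀ • (1 : Matrix (Fin m) (Fin m) ℂ) :=
      eq_smul_one_of_constant hP₂ h₂ fun i => hcb i i₀
    have hg₃ : (g.2.2 : Matrix (Fin m) (Fin m) ℂ) = c i₀ • (1 : Matrix (Fin m) (Fin m) ℂ) :=
      eq_smul_one_of_constant hP₃ h₃ fun i => hcc i i₀
    refine ⟨a i₀, b i₀, c i₀, ?_, hg₁, hg₂, hg₃⟩
    rw [hg₁, hg₂, hg₃, actTensor_smul_fst, actTensor_smul_snd, actTensor_smul_thd, smul_smul,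
      smul_smul, actTensor_one] at hg
    -- `(abc) • w = w`, `w ≠ 0`
    have h1 : (a i₀ * b i₀ * c i₀ - 1) • w = 0 := by rw [sub_smul, one_smul, hg, sub_self]
    rcases smul_eq_zero.mp h1 with h2 | h2
    · exact sub_eq_zero.mp h2
    · exact absurd h2 hw0

/-- **Almost all `w ∈ ⊗³ℂ^m`, `m ≥ 4`, have a trivial stabilizer** (A. M. Popov 1987 Thm. 2 as
quoted in BI 2017, proof of Thm. 4.2), over `ℂ`, by the elementary route of this file.
[cite: BurgisserIkenmeyer2017, Thm. 4.2 (proof, "if m > 3, then almost all w have a trivial stabilizer")] -/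
theorem isZariskiGenericTensor_hasTrivialTensorStabilizer (hm : 4 ≤ m) :
    IsZariskiGenericTensor (HasTrivialTensorStabilizer : (Fin m → Fin m → Fin m → ℂ) → Prop) := by
  classical
  have hm0 : 0 < m := by omega
  -- (1) generic finiteness of the mixed stabilizer and non-vanishing
  obtain ⟨F₁, hF₁0, hF₁⟩ := isZariskiGenericTensor_finite_mixedStab hm
  obtain ⟨F₀, hF₀0, hF₀⟩ := isZariskiGenericTensor_ne_zero (K := ℂ) (⟨0, hm0⟩ : Fin m)
  -- (2) generic avoidance of every small triple chart (finitely many data)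
  have hchart : ∀ d : ((Fin m → Fin m) × (Fin m → Fin m)) × ((Fin m → Fin m) × (Fin m → Fin m)) ×
      ((Fin m → Fin m) × (Fin m → Fin m)) × Finset (Fin m × Fin m × Fin m),
      IsZariskiGenericTensor fun w : Fin m → Fin m → Fin m → ℂ =>
        Fintype.card (chartVars d.1.1 d.1.2 ⊕ chartVars d.2.1.1 d.2.1.2 ⊕ chartVars d.2.2.1.1 d.2.2.1.2)
            + d.2.2.2.card < m ^ 3 →
          w ∉ tensorChartImage ((chartMatrix ℂ d.1.1 d.1.2).map (rename Sum.inl))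
            ((chartMatrix ℂ d.2.1.1 d.2.1.2).map (rename (Sum.inr ∘ Sum.inl)))
            ((chartMatrix ℂ d.2.2.1.1 d.2.2.1.2).map (rename (Sum.inr ∘ Sum.inr))) d.2.2.2 := by
    intro d
    by_cases hlt : Fintype.card (chartVars d.1.1 d.1.2 ⊕ chartVars d.2.1.1 d.2.1.2 ⊕
        chartVars d.2.2.1.1 d.2.2.1.2) + d.2.2.2.card < m ^ 3
    · have hlt' : Fintype.card (chartVars d.1.1 d.1.2 ⊕ chartVars d.2.1.1 d.2.1.2 ⊕
          chartVars d.2.2.1.1 d.2.2.1.2) + d.2.2.2.card < Fintype.card (Fin m) ^ 3 := by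
        rwa [Fintype.card_fin]
      exact (isZariskiGenericTensor_not_mem_tensorChartImage _ _ _ _ hlt').mono
        fun w hw _ => hw
    · exact IsZariskiGenericTensor.of_forall fun w h => absurd h hlt
  obtain ⟨F₂, hF₂0, hF₂⟩ := IsZariskiGenericTensor.forall_fintype hchart
  refine ⟨F₀ * F₁ * F₂, mul_ne_zero (mul_ne_zero hF₀0 hF₁0) hF₂0, fun w hFw => ?_⟩
  rw [map_mul, map_mul] at hFw
  have hw0 : w ≠ 0 := hF₀ w (left_ne_zero_of_mul (left_ne_zero_of_mul hFw))
  have hfin : (mixedStab w).Finite := hF₁ w (right_ne_zero_of_mul (left_ne_zero_of_mul hFw))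
  have havoid := hF₂ w (right_ne_zero_of_mul hFw)
  exact hasTrivialTensorStabilizer_of_finite_mixedStab hm hw0 hfin
    fun blk₁ ρ₁ blk₂ ρ₂ blk₃ ρ₃ S hlt => havoid ((blk₁, ρ₁), (blk₂, ρ₂), (blk₃, ρ₃), S) hlt

/-- **BI 2017, proof of Thm. 4.2 (A. M. Popov 1987 Thm. 2, as quoted, TeX L1616–1618) —
DISCHARGED**: "if `m > 3`, then almost all `w ∈ ⊗³ℂ^m` have a trivial stabilizer group."
[cite: BurgisserIkenmeyer2017, Thm. 4.2 (proof)] -/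
theorem BI2017_popov_trivialStabilizer_holds : BI2017_popov_trivialStabilizer :=
  fun _ hm => isZariskiGenericTensor_hasTrivialTensorStabilizer hm

/-- **BI 2017, Thm. 4.2 — DISCHARGED** ("We have `a(m) = 1` for `m ≥ 3` and `a(2) = 2`"): the
tree's edge `BI2017_thm_4_2_of_popov` (generic period `1` for `m ≥ 4` from the trivial stabilizer,
`m = 3` and `m = 2` proved there) fed with `BI2017_popov_trivialStabilizer_holds`.
[cite: BurgisserIkenmeyer2017, Thm. 4.2] -/
theorem BI2017_thm_4_2_holds : BI2017_thm_4_2 :=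
  BI2017_thm_4_2_of_popov BI2017_popov_trivialStabilizer_holds

end Assembly

end Literature.Computability.AlgebraicComplexity

end
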